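import Literature.AlgebraicGeometry.Frobenioids.ModelFrobenioidPowerFunctor
import Literature.AnabelianGeometry.EtaleTheta.TemperedFrobenioidCor38SubPreStepsPartners
import HarnessLib

/-!
# [EtTh] Cor. 3.8 proof row C38-L02a `PreservesPreSteps` (F-2809): the FROBENIUS FACTORISATION hand —
# the degree of the image of a pre-step can only move where a PURE Frobenius morphism is fiberwise-surjective

S. Mochizuki, *The étale theta function and its Frobenioid-theoretic manifestations*, Publ. RIMS **45** (2009)
[EtTh], Cor. 3.8, proof, PDF p. 81 l. 2–3 ("by [Mzk17], Theorem 3.4, (ii) … it follows that `Ψ` preserves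
pre-steps") [cite: MochizukiEtTh2009, Cor 3.8 p.81]; S. Mochizuki, *The geometry of Frobenioids I*, Kyushu J. Math.
**62** (2008) [FrdI], §0 p. 14 (fiberwise-surjective morphisms), p. 16 ("if `α ∘ β` is an isomorphism, then `α`,
`β` are isomorphisms" in a totally epimorphic category), Def. 1.2 (iii) p. 22 (pre-steps), Def. 1.3 (iv)(a) p. 24
(factorisation through a morphism of Frobenius type), Thm. 5.2 (i) p. 100 (model Frobenioids)
[cite: MochizukiFrdI2008, Thm. 5.2(i) p.100].

abc-iut cell, block C / W6, seat abc-iut-w6-d040 (gen 4).  PROOF-ONLY file (0 definitions, 0 instances, 0 notation), a further HAND for the decision on the bare universal closure of `Cor38Hyp.PreservesPreSteps`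
(FACT-LIST F-2809, lease abc-iut-f-032), on top of abc-iut-w6-d057 (`…PreStepsBaseFS`: the image of a pre-step under
any equivalence is FIBERWISE-SURJECTIVE), abc-iut-f-146 (`…OTriDegreeAll`), abc-iut-f-109 / abc-iut-w6-d079
(`…PreStepsPartners`, `…PreStepsMonoDescent`) and abc-iut-f-111 (`…PreStepsUnitObstruction`: a fiberwise-surjective
morphism over a MONIC base arrow is linear given a genuine-unit `d`-th-power obstruction).  WHAT IS PROVED:

* **Frobenius factorisation in ANY model Frobenioid** (`ModelFrobenioid.exists_powUnitHom_comp_eq`): every morphism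
  `φ = (d, f, Z, u) : (A, α) → (A', α')` is `F_d ≫ φ_lin` with `F_d = (d, id, 0, 0) : (A, α) → (A, d·α)` the PURE
  Frobenius morphism (abc-iut-L6-t10's `ModelFrobenioid.powUnitHom`, consumed BY NAME) and `φ_lin = (1, f, Z, u)` linear.
* **Pure Frobenius morphisms resist fiberwise-surjectivity** (`ModelFrobenioid.not_isFiberwiseSurjective_powUnitHom`,
  `B` group-like): if `e ≥ 2` and some `u ∈ B(A)` — ANY rational function, not necessarily a genuine unit — has
  `z₀^e · Div_B u` effective (`= Z`) while NO pull-back `g^* u` is an `e`-th power in `B`, then `F_e : (A, α) →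
  (A, e·α)` is not fiberwise-surjective: the arrow `Γ = (e, id, Z, u) : (A, α·z₀⁻¹) → (A, e·α)` admits no completing
  square (`Base F_e = id`, so the bases of a completing square AGREE without any monicity, and the unit coordinates
  give `g^* u = (u_{δ_B} u_{δ_X}⁻¹)^e`).
* **Factors of pre-steps** (`TemperedFrobenioid.opsData_isPreStep_of_comp_left/right`): over a typed tempered
  Frobenioid (`D` totally epimorphic, Def. 3.6 (ii)) both factors of a pre-step are pre-steps; isomorphisms and
  composites of pre-steps are pre-steps.
* Hence, for EVERY equivalence `e : C₁ ⥲ C₂` of the Frobenioids of two typed tempered Frobenioids and every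
  pre-step `φ : X → Y` of `C₁` (`TemperedFrobenioid.isFiberwiseSurjective_powUnitHom_of_isPreStep`): `e⁻¹(F_d)`,
  `d := deg_Fr(e φ)`, is a left factor of the pre-step `e⁻¹ e φ`, hence a pre-step, hence (abc-iut-w6-d057) its
  image is fiberwise-surjective — i.e. **the pure Frobenius morphism `F_d` at `e X` is fiberwise-surjective in
  `C₂`**; consequently (`TemperedFrobenioid.isLinear_map_of_isPreStep_of_powerObstruction`) the DEGREE HALF of the
  row for every pre-step, WITHOUT abc-iut-f-111's hypothesis "`Base(e φ)` monic" and with the obstruction carried by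
  ANY effective principal divisor none of whose pull-backs is a `d`-th power (so also over beds with TRIVIAL `O^×`,
  e.g. the `Toy` family, and over sparse `Div_B(B) = k·ℤ`).  The `Cor38Hyp` wrappers and the closers of the row are in
  the companion file `TemperedFrobenioidCor38SubPreStepsPowerObstruction.lean` (same seat).
READING (cell rule R5; FACT-LIST label of F-2809 NOT moved: conditional / instance PROVED / bare closure open): a
separating record must move a partner-less pre-step EITHER to a linear morphism over a non-invertible FSM arrow between
two distinct objects of `D₂`, OR to a linear morphism over a non-monic fiberwise-surjective arrow, OR to a morphism of
degree `e ≥ 2` at an object `A` where EVERY `u ∈ B(A)` with `z₀^e·Div_B u` effective has a pull-back that is an `e`-th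
power (`B(A)` "`e`-divisible up to pull-back": no valuation at all, e.g. `B` trivial, divisible or torsion) — the
monic-base qualifier of the earlier census is gone.  No [FrdI] Thm. 3.4 input; no Frobenioid axiom; vocabulary
clauses untouched.
HONEST FRAMING: bookkeeping about OUR typed Def. 3.6 interface (print's Cor. 3.8 quotes [FrdI] Thm. 3.4 (ii) for
genuine Frobenioids); nothing here bears on [IUTchIII] Cor. 3.12; no side taken; a FACT row is an assumption label;
typed ≠ proved.
-/

namespace Literature.AlgebraicGeometry.Frobenioids

open CategoryTheory Opposite

universe w v u

/-! ## §0 Two bookkeeping lemmas: `ℕ_{≥1}` and fiberwise-surjectivity under isomorphisms -/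

/-- In `ℕ_{≥1}` a product equal to `1` has both factors equal to `1`. [folklore] -/
private theorem pnat_eq_one_and_eq_one_of_mul_eq_one {a b : ℕ+} (h : a * b = 1) : a = 1 ∧ b = 1 := by
  have h' : (a : ℕ) * (b : ℕ) = 1 := by exact_mod_cast congrArg PNat.val h
  exact ⟨PNat.coe_eq_one_iff.mp (Nat.eq_one_of_mul_eq_one_right h'),
    PNat.coe_eq_one_iff.mp (Nat.eq_one_of_mul_eq_one_left h')⟩

/-- Fiberwise-surjectivity ([FrdI] §0 p. 14) is insensitive to composition with isomorphisms on either side: if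
`i ≫ β ≫ j` is fiberwise-surjective for isomorphisms `i`, `j`, so is `β`. [cite: MochizukiFrdI2008, §0 p.14] -/
theorem IsFiberwiseSurjective.of_iso_comp_iso {C : Type u} [Category.{v} C] {B' B A A' : C} {β : B ⟶ A}
    (i : B' ≅ B) (j : A ≅ A') (hβ : IsFiberwiseSurjective (i.hom ≫ β ≫ j.hom)) :
    IsFiberwiseSurjective β := by
  intro X γ
  obtain ⟨W, δB, δX, hsq⟩ := hβ (γ ≫ j.hom)
  refine ⟨W, δB ≫ i.hom, δX, (cancel_mono j.hom).mp ?_⟩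
  simpa only [Category.assoc] using hsq

/-! ## §1 Model Frobenioids: the Frobenius factorisation and the non-surjectivity of pure Frobenius morphisms -/

namespace ModelFrobenioid

variable {D : Type u} [Category.{v} D] {Φ B : Dᵒᵖ ⥤ CommMonCat.{w}} {DivB : B ⟶ monoidGp Φ}

/-- Pull-back along an identity of `D` is the identity (bookkeeping). [cite: MochizukiFrdI2008, Thm. 5.2(i) p.100] -/
private theorem map_id_op_apply (Ψ : Dᵒᵖ ⥤ CommMonCat.{w}) (A : D) (x : (Ψ.obj (op A) : Type w)) :
    (Ψ.map (𝟙 A).op).hom x = x := by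
  rw [op_id, Ψ.map_id, CommMonCat.hom_id, MonoidHom.id_apply]

/-- **Frobenius factorisation** (the shape of [FrdI] Def. 1.3 (iv)(a) "`φ = α ∘ β ∘ γ` with `γ` of Frobenius type",
valid in EVERY model Frobenioid, with no Frobenioid axiom): every `φ = (d, f, Z, u) : (A_D, α) → (A'_D, α')` factors as
the PURE Frobenius morphism `(d, id, 0, 0) : (A_D, α) → (A_D, d·α)` (abc-iut-L6-t10's `ModelFrobenioid.powUnitHom`,
[FrdI] Thm. 5.2 proof of (ii) p. 101) followed by the LINEAR morphism `(1, f, Z, u) : (A_D, d·α) → (A'_D, α')` (whose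
relation (d) is literally that of `φ`). [cite: MochizukiFrdI2008, Def. 1.3 (iv) p.24] -/
theorem exists_powUnitHom_comp_eq {X Y : ModelFrobenioid Φ B DivB} (φ : X ⟶ Y) :
    ∃ L : powObj Φ B DivB (degFr φ) X ⟶ Y, degFr L = 1 ∧ powUnitHom Φ B DivB (degFr φ) X ≫ L = φ := by
  let L : powObj Φ B DivB (degFr φ) X ⟶ Y :=
    { degFr := 1
      base := baseMap (X := X) (Y := Y) φ
      div := div (X := X) (Y := Y) φ
      unit := unit (X := X) (Y := Y) φ
      rel := by
        change (X.cls ^ (degFr φ : ℕ)) ^ ((1 : ℕ+) : ℕ) * Algebra.GrothendieckGroup.of (div φ) =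
          pullGp Φ (baseMap φ) Y.cls * divB Φ B DivB (op X.base) (unit φ)
        rw [PNat.one_coe, pow_one]
        exact rel φ }
  refine ⟨L, rfl, hom_ext ?_ ?_ ?_ ?_⟩
  · change 1 * degFr φ = degFr φ
    exact one_mul _
  · change 𝟙 X.base ≫ baseMap φ = baseMap φ
    exact Category.id_comp _
  · change (Φ.map (𝟙 X.base).op).hom (div φ) * 1 ^ ((1 : ℕ+) : ℕ) = div φ
    rw [PNat.one_coe, pow_one, mul_one]
    exact map_id_op_apply Φ X.base (div φ)
  · change (B.map (𝟙 X.base).op).hom (unit φ) * 1 ^ ((1 : ℕ+) : ℕ) = unit φ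
    rw [PNat.one_coe, pow_one, mul_one]
    exact map_id_op_apply B X.base (unit φ)

/-- **A pure Frobenius morphism `F_e`, `e ≥ 2`, is NOT fiberwise-surjective as soon as some rational function
`u ∈ B(A_D)` with `z₀^e · Div_B(u)` EFFECTIVE has no pull-back that is an `e`-th power** (`B` group-like).  The
obstruction arrow is `Γ = (e, id, Z, u) : (A_D, α·z₀⁻¹) → (A_D, e·α)` with `Z = z₀^e·Div_B(u)`: in a completing
square `δ_B ≫ F_e = δ_X ≫ Γ` the unit coordinates read `u_{δ_B}^e = g^*u · u_{δ_X}^e`, `g := Base δ_X` (no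
monicity of any base arrow is needed: `u_{F_e} = 0` kills the `δ_B`-side pull-back). [cite: MochizukiFrdI2008, Thm. 5.2(i) p.100] -/
theorem not_isFiberwiseSurjective_powUnitHom (hB : ∀ (A : Dᵒᵖ) (b : (B.obj A : Type w)), IsUnit b)
    (X : ModelFrobenioid Φ B DivB) {e : ℕ+} (u : (B.obj (op X.base) : Type w))
    (z₀ z : (Φ.obj (op X.base) : Type w))
    (hz : Algebra.GrothendieckGroup.of z =
      Algebra.GrothendieckGroup.of z₀ ^ (e : ℕ) * divB Φ B DivB (op X.base) u)
    (hnot : ∀ ⦃E : D⦄ (g : E ⟶ X.base) (t : (B.obj (op E) : Type w)), (B.map g.op).hom u ≠ t ^ (e : ℕ)) :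
    ¬ IsFiberwiseSurjective (powUnitHom Φ B DivB e X) := by
  intro hF
  -- the obstruction arrow `Γ = (e, id, z, u) : (A, α · z₀⁻¹) → (A, e·α)`
  let W : ModelFrobenioid Φ B DivB := ⟨X.base, X.cls * (Algebra.GrothendieckGroup.of z₀)⁻¹⟩
  let Γ : W ⟶ powObj Φ B DivB e X :=
    { degFr := e
      base := 𝟙 X.base
      div := z
      unit := u
      rel := by
        change (X.cls * (Algebra.GrothendieckGroup.of z₀)⁻¹) ^ (e : ℕ) * Algebra.GrothendieckGroup.of z =
          pullGp Φ (𝟙 X.base) (X.cls ^ (e : ℕ)) * divB Φ B DivB (op X.base) u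
        rw [pullGp_id, hz, mul_pow, inv_pow, mul_assoc, inv_mul_cancel_left] }
  obtain ⟨V, δB, δX, hsq⟩ := hF Γ
  -- the unit coordinates of the square (the `Base` coordinates are not even needed: `u_{F_e} = 0`)
  have hu : (B.map (baseMap δB).op).hom 1 * unit δB ^ (e : ℕ) =
      (B.map (baseMap δX).op).hom u * unit δX ^ (e : ℕ) := congrArg Hom.unit hsq
  rw [map_one, one_mul] at hu
  obtain ⟨U, hU⟩ := hB _ (unit δX)
  refine hnot (baseMap (X := V) (Y := W) δX) (unit δB * ↑U⁻¹) ?_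
  rw [mul_pow, hu, ← hU, mul_assoc, ← mul_pow, Units.mul_inv, one_pow, mul_one]

/-- The genuine-unit form (abc-iut-f-111's obstruction, `Div_B v = 0`, is the case `z₀ = Z = 0`): a pure
Frobenius morphism `F_e` is not fiberwise-surjective if some genuine unit has no `e`-th-power pull-back.
[cite: MochizukiFrdI2008, Thm. 5.2(i) p.100] -/
theorem not_isFiberwiseSurjective_powUnitHom_of_unit (hB : ∀ (A : Dᵒᵖ) (b : (B.obj A : Type w)), IsUnit b)
    (X : ModelFrobenioid Φ B DivB) {e : ℕ+} (v : (B.obj (op X.base) : Type w))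
    (hv : divB Φ B DivB (op X.base) v = 1)
    (hnot : ∀ ⦃E : D⦄ (g : E ⟶ X.base) (t : (B.obj (op E) : Type w)), (B.map g.op).hom v ≠ t ^ (e : ℕ)) :
    ¬ IsFiberwiseSurjective (powUnitHom Φ B DivB e X) :=
  not_isFiberwiseSurjective_powUnitHom hB X v 1 1 (by rw [hv, map_one, one_pow, mul_one]) hnot

end ModelFrobenioid

end Literature.AlgebraicGeometry.Frobenioids

/-! ## §2 The row C38-L02a over the typed Def. 3.6 interface -/

namespace Literature.AnabelianGeometry.EtaleTheta

open CategoryTheory Opposite Literature.AlgebraicGeometry.Frobenioids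

universe u₀ v₀ u v w

variable {D₀ : Type u₀} [Category.{v₀} D₀] {V : FrdIMonoidStub.{w}}
  {T : RealifiedDivisorMonoids (D₀ := D₀) V} {D : Type u} [Category.{v} D] {VD : FrdICatStub.{u, v, w} D}

namespace TemperedFrobenioid

variable (C : TemperedFrobenioid T D VD)

/-- The composite of two pre-steps is a pre-step ([FrdI] Def. 1.2 (iii): degrees multiply, bases compose).
[cite: MochizukiFrdI2008, Def. 1.2 (iii) p.22] -/
theorem opsData_isPreStep_comp {X Y Z : C.category} (a : X ⟶ Y) (b : Y ⟶ Z) (ha : C.opsData.IsPreStep a)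
    (hb : C.opsData.IsPreStep b) : C.opsData.IsPreStep (a ≫ b) := by
  obtain ⟨ha₁, ha₂⟩ := (C.opsData_isPreStep_iff a).1 ha
  obtain ⟨hb₁, hb₂⟩ := (C.opsData_isPreStep_iff b).1 hb
  refine (C.opsData_isPreStep_iff _).2 ⟨?_, ?_⟩
  · rw [ModelFrobenioid.degFr_comp, ha₁, hb₁, mul_one]
  · rw [ModelFrobenioid.baseMap_comp]
    exact IsIso.comp_isIso

/-- **A LEFT factor of a pre-step is a pre-step** (`D` totally epimorphic, Def. 3.6 (ii); [FrdI] §0 p. 16: if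
`α ∘ β` is an isomorphism then so are `α`, `β`; degrees multiply in `ℕ_{≥1}`). [cite: MochizukiEtTh2009, Def 3.6 p.77] -/
theorem opsData_isPreStep_of_comp_left {X Y Z : C.category} (a : X ⟶ Y) (b : Y ⟶ Z)
    (hab : C.opsData.IsPreStep (a ≫ b)) : C.opsData.IsPreStep a := by
  obtain ⟨hd, hiso⟩ := (C.opsData_isPreStep_iff _).1 hab
  rw [ModelFrobenioid.degFr_comp] at hd
  refine (C.opsData_isPreStep_iff a).2 ⟨(pnat_eq_one_and_eq_one_of_mul_eq_one hd).2, ?_⟩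
  rw [ModelFrobenioid.baseMap_comp] at hiso
  haveI := hiso
  exact (C.isTotallyEpimorphic.isIso_of_isIso_comp (ModelFrobenioid.baseMap a) (ModelFrobenioid.baseMap b)).2

/-- **A RIGHT factor of a pre-step is a pre-step** (same mechanism). [cite: MochizukiEtTh2009, Def 3.6 p.77] -/
theorem opsData_isPreStep_of_comp_right {X Y Z : C.category} (a : X ⟶ Y) (b : Y ⟶ Z)
    (hab : C.opsData.IsPreStep (a ≫ b)) : C.opsData.IsPreStep b := by
  obtain ⟨hd, hiso⟩ := (C.opsData_isPreStep_iff _).1 hab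
  rw [ModelFrobenioid.degFr_comp] at hd
  refine (C.opsData_isPreStep_iff b).2 ⟨(pnat_eq_one_and_eq_one_of_mul_eq_one hd).1, ?_⟩
  rw [ModelFrobenioid.baseMap_comp] at hiso
  haveI := hiso
  exact (C.isTotallyEpimorphic.isIso_of_isIso_comp (ModelFrobenioid.baseMap a) (ModelFrobenioid.baseMap b)).1

/-- Identities are pre-steps. [cite: MochizukiFrdI2008, Def. 1.2 (iii) p.22] -/
theorem opsData_isPreStep_id (X : C.category) : C.opsData.IsPreStep (𝟙 X) :=
  (C.opsData_isPreStep_iff _).2 ⟨rfl, by rw [ModelFrobenioid.baseMap_id]; infer_instance⟩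

/-- Isomorphisms are pre-steps (an isomorphism is a left factor of an identity).
[cite: MochizukiFrdI2008, Def. 1.2 (iii) p.22] -/
theorem opsData_isPreStep_iso_hom {X Y : C.category} (j : X ≅ Y) : C.opsData.IsPreStep j.hom :=
  C.opsData_isPreStep_of_comp_left j.hom j.inv (by rw [Iso.hom_inv_id]; exact C.opsData_isPreStep_id X)

/-- Inverses of isomorphisms are pre-steps. [cite: MochizukiFrdI2008, Def. 1.2 (iii) p.22] -/
theorem opsData_isPreStep_iso_inv {X Y : C.category} (j : X ≅ Y) : C.opsData.IsPreStep j.inv :=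
  C.opsData_isPreStep_iso_hom j.symm

end TemperedFrobenioid

section Rows

variable {D₀' : Type u₀} [Category.{v₀} D₀'] {T' : RealifiedDivisorMonoids (D₀ := D₀') V}
  {D' : Type u} [Category.{v} D'] {VD' : FrdICatStub.{u, v, w} D'}
  {C₁ : TemperedFrobenioid T D VD} {C₂ : TemperedFrobenioid T' D' VD'}

namespace TemperedFrobenioid

/-- Under ANY equivalence `e : C₁ ⥲ C₂` of the Frobenioids of two typed tempered Frobenioids, `e⁻¹ e φ` is a
pre-step when `φ` is (it is `φ` conjugated by the unit isomorphisms). [cite: MochizukiEtTh2009, Cor 3.8 p.81] -/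
theorem isPreStep_inverse_map_functor_map (e : C₁.category ≌ C₂.category) {X Y : C₁.category} (φ : X ⟶ Y)
    (hφ : C₁.opsData.IsPreStep φ) : C₁.opsData.IsPreStep (e.inverse.map (e.functor.map φ)) := by
  rw [Equivalence.inv_fun_map]
  exact C₁.opsData_isPreStep_comp _ _ (C₁.opsData_isPreStep_iso_inv (e.unitIso.app X))
    (C₁.opsData_isPreStep_comp _ _ hφ (C₁.opsData_isPreStep_iso_hom (e.unitIso.app Y)))

/-- **The pre-step over the pure Frobenius part of the image.**  For any equivalence `e : C₁ ⥲ C₂` and any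
pre-step `φ : X → Y` of `C₁`, the morphism `e⁻¹(F_d)`, `d := deg_Fr(e φ)`, `F_d` the pure Frobenius morphism out
of `e X`, is a LEFT FACTOR of the pre-step `e⁻¹ e φ` (Frobenius factorisation `e φ = F_d ≫ (e φ)_lin`), hence a
pre-step of `C₁`. [cite: MochizukiEtTh2009, Cor 3.8 p.81] -/
theorem isPreStep_inverse_map_powUnitHom (e : C₁.category ≌ C₂.category) {X Y : C₁.category} (φ : X ⟶ Y)
    (hφ : C₁.opsData.IsPreStep φ) :
    C₁.opsData.IsPreStep (e.inverse.map (ModelFrobenioid.powUnitHom C₂.divisorMonoid C₂.ratFnFunctor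
      C₂.divBNatTrans (ModelFrobenioid.degFr (e.functor.map φ)) (e.functor.obj X))) := by
  have hpre := isPreStep_inverse_map_functor_map e φ hφ
  obtain ⟨L, -, hL⟩ := ModelFrobenioid.exists_powUnitHom_comp_eq (e.functor.map φ)
  rw [← hL, Functor.map_comp] at hpre
  exact C₁.opsData_isPreStep_of_comp_left _ _ hpre

/-- **For any equivalence `e : C₁ ⥲ C₂` and any pre-step `φ : X → Y` of `C₁`, the PURE FROBENIUS morphism
`F_d : e X → (e X)^{(d)}`, `d := deg_Fr(e φ)`, is fiberwise-surjective in `C₂`** (it is, up to the counit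
isomorphisms, the image of the pre-step `e⁻¹(F_d)`; abc-iut-w6-d057: images of pre-steps are fiberwise-surjective).
[cite: MochizukiEtTh2009, Cor 3.8 p.81] -/
theorem isFiberwiseSurjective_powUnitHom_of_isPreStep (e : C₁.category ≌ C₂.category) {X Y : C₁.category}
    (φ : X ⟶ Y) (hφ : C₁.opsData.IsPreStep φ) :
    IsFiberwiseSurjective (ModelFrobenioid.powUnitHom C₂.divisorMonoid C₂.ratFnFunctor C₂.divBNatTrans
      (ModelFrobenioid.degFr (e.functor.map φ)) (e.functor.obj X)) := by
  have hFS : IsFiberwiseSurjective (e.functor.map (e.inverse.map (ModelFrobenioid.powUnitHom C₂.divisorMonoid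
      C₂.ratFnFunctor C₂.divBNatTrans (ModelFrobenioid.degFr (e.functor.map φ)) (e.functor.obj X)))) :=
    IsFiberwiseSurjective.map_equivalence e
      (C₁.isFiberwiseSurjective_of_isPreStep _ (isPreStep_inverse_map_powUnitHom e φ hφ))
  rw [Equivalence.fun_inv_map] at hFS
  exact IsFiberwiseSurjective.of_iso_comp_iso (e.counitIso.app _) (e.counitIso.app _).symm hFS

/-- **DEGREE HALF of row C38-L02a from a power obstruction, for any equivalence**: if at every object of `D₂`
and for every `d ≥ 2` some `u ∈ B(A)` of `C₂` with `z₀^d·Div_B(u)` effective has no pull-back that is a `d`-th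
power, then `e φ` is LINEAR for every pre-step `φ` of `C₁` — no hypothesis on `Base(e φ)`, no partner.
[cite: MochizukiEtTh2009, Cor 3.8 p.81] -/
theorem isLinear_map_of_isPreStep_of_powerObstruction (e : C₁.category ≌ C₂.category)
    (hK : ∀ (A : D') (d : ℕ+), d ≠ 1 → ∃ (u : (C₂.ratFnFunctor.obj (op A) : Type w))
      (z₀ z : (C₂.divisorMonoid.obj (op A) : Type w)),
      Algebra.GrothendieckGroup.of z = Algebra.GrothendieckGroup.of z₀ ^ (d : ℕ) *
        Literature.AlgebraicGeometry.Frobenioids.divB C₂.divisorMonoid C₂.ratFnFunctor C₂.divBNatTrans (op A) u ∧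
      ∀ ⦃E : D'⦄ (g : E ⟶ A) (t : (C₂.ratFnFunctor.obj (op E) : Type w)),
        (C₂.ratFnFunctor.map g.op).hom u ≠ t ^ (d : ℕ))
    {X Y : C₁.category} (φ : X ⟶ Y) (hφ : C₁.opsData.IsPreStep φ) :
    C₂.opsData.IsLinear (e.functor.map φ) := by
  change ModelFrobenioid.degFr (e.functor.map φ) = 1
  by_contra hne
  obtain ⟨u, z₀, z, hz, hnot⟩ := hK (e.functor.obj X).base (ModelFrobenioid.degFr (e.functor.map φ)) hne
  exact ModelFrobenioid.not_isFiberwiseSurjective_powUnitHom (fun _ b => C₂.isUnit_ratFn (T'.isUnit_BΛ _) b)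
    (e.functor.obj X) u z₀ z hz hnot (isFiberwiseSurjective_powUnitHom_of_isPreStep e φ hφ)

end TemperedFrobenioid

end Rows

end Literature.AnabelianGeometry.EtaleTheta
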